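import Summits.CriticalPhenomena.CardyFormulaZ2.Theorems.CardyMagicRigidityNestingRigidityNeckZ2NodeProduct
import HarnessLib

/-!
# Crux `NestingRigidity`, line `pinch-resampling` (v4), stub S12: recentring four-arm node events and nets on the inner layer

Crux `Summit.CriticalPhenomena.CardyFormulaZ2.Theses.CardyMagicRigidity.NestingRigidity`
(stmt-CriticalPhenomena-4835), line `pinch-resampling` v4, stub S12 `stub_neckHookupCoarseZ2 : NeckHookupCoarseZ2`.
The two lattice-specific COUNTING primitives of the multi-scale summation of the node events of `…NeckZ2ErrorCover`
(S11 road map, item 2: a hierarchy node "at scale `D`" is positioned at resolution `D` on the inner layer, and its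
four-arm event must then be an event depending on the coarse position only), on top of `…NeckZ2NodeProduct`:

* §1 `NeckCoarseZ2.crossings_of_mem_fourArmTwoClustersAt` — unpacking the tree's event into two open crossings of
  `zAnn w r R` in distinct open clusters of the annulus (converse of `mem_fourArmTwoClustersAt_of_crossings`).
* §2 **Recentring** `NeckCoarseZ2.fourArmTwoClustersAt_of_near`: on a lattice configuration, four arms across
  `zAnn w r R` give four arms across every annulus `zAnn w' r' R'` inside it, `|w' - w|_∞ ≤ d`, `r + d + 1 ≤ r' ≤ R'`,
  `R' + d ≤ R` (crossing extraction `exists_zAnn_crossing_of_pathIn`).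
* §3 **Nets on the inner layer** `NeckCoarseZ2.ilNet x s D`: at most `4 (2s/D + 1)` inner-layer vertices within sup
  distance `< D` of every inner-layer vertex (`card_ilNet_le`, `ilNet_subset_innerLayer`, `exists_mem_ilNet_near`).
* §4 The resulting union bound (`real_exists_fourArm_innerLayer_le`, registered anchor): the probability that SOME
  inner-layer vertex is surrounded by four arms from radius `r` to radius `R` is at most
  `4 (2s/D + 1) · c ((r+D+1)/(R-D))^{1+ε}` with the constants of `QuadCrossing.fourArm_bound` — position entropy
  `s/D` against the four-arm cost, the `k = 1` layer of the summation.
-/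

noncomputable section

namespace Summit.CriticalPhenomena.CardyFormulaZ2.Cruxes.NestingRigidity.PinchResampling

open MeasureTheory Set Literature.Probability.Percolation Literature.Probability.LatticeModels
open ZPinchLocality

namespace NeckCoarseZ2

variable {ω : BondConfig (Site 2)}

/-! ## §1 Unpacking the four-arm event -/

/-- The tree's cluster-form four-arm event around `w` yields two open crossings of `zAnn w r R` in distinct open
clusters of the annulus. -/
theorem crossings_of_mem_fourArmTwoClustersAt {w : Site 2} {r R : ℕ} (hr : 1 ≤ r) (hrR : r ≤ R)
    (h : ω ∈ fourArmTwoClustersAt w r R) :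
    ∃ p₁ q₁ p₂ q₂, zNorm (p₁ - w) = r ∧ zNorm (q₁ - w) = R ∧ zNorm (p₂ - w) = r ∧ zNorm (q₂ - w) = R ∧
      PathIn (openGraph ω) (zAnn w r R) p₁ q₁ ∧ PathIn (openGraph ω) (zAnn w r R) p₂ q₂ ∧
      ¬ PathIn (openGraph ω) (zAnn w r R) p₁ p₂ := by
  have hR : 1 ≤ R := hr.trans hrR
  obtain ⟨p₁, hp₁, p₂, hp₂, q₁, hq₁, q₂, hq₂, h₁, h₂, hn⟩ := h
  rw [image_add_sqAnnulus_eq_zAnn hr, DCT16.mem_openConnIn_iff_pathIn] at h₁ h₂ hn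
  exact ⟨p₁, q₁, p₂, q₂, (mem_siteSphere_iff_zNorm hr).1 hp₁, (mem_siteSphere_iff_zNorm hR).1 hq₁,
    (mem_siteSphere_iff_zNorm hr).1 hp₂, (mem_siteSphere_iff_zNorm hR).1 hq₂, h₁, h₂, hn⟩

/-! ## §2 Recentring -/

/-- An annulus around a nearby centre with shrunken radii lies inside the original annulus. -/
theorem zAnn_subset_zAnn_of_near {w w' : Site 2} {d r R r' R' : ℕ} (hd : zNorm (w' - w) ≤ d) (hr' : r + d + 1 ≤ r')
    (hR' : R' + d ≤ R) : zAnn w' r' R' ⊆ zAnn w r R := by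
  rintro z ⟨hz1, hz2⟩
  have h1 := zNorm_sub_le_add z w w'
  have h2 := zNorm_sub_le_add z w' w
  have h3 : zNorm (w - w') = zNorm (w' - w) := zNorm_sub_comm _ _
  constructor <;> omega

/-- **Recentring the four-arm event**: on a lattice configuration, four arms across `zAnn w r R` give four arms across
every annulus `zAnn w' r' R'` with `|w' - w|_∞ ≤ d`, `r + d + 1 ≤ r' ≤ R'`, `R' + d ≤ R`. -/
theorem fourArmTwoClustersAt_of_near (hHG : ∀ a b, (openGraph ω).Adj a b → (zdGraph 2).Adj a b) {w w' : Site 2}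
    {d r R r' R' : ℕ} (hd : zNorm (w' - w) ≤ d) (hr : 1 ≤ r) (hr' : r + d + 1 ≤ r') (hrR' : r' ≤ R')
    (hR' : R' + d ≤ R) (h : ω ∈ fourArmTwoClustersAt w r R) : ω ∈ fourArmTwoClustersAt w' r' R' := by
  have hrR : r ≤ R := by omega
  obtain ⟨p₁, q₁, p₂, q₂, hp₁, hq₁, hp₂, hq₂, h₁, h₂, hn⟩ := crossings_of_mem_fourArmTwoClustersAt hr hrR h
  have hsub : zAnn w' r' R' ⊆ zAnn w r R := zAnn_subset_zAnn_of_near hd hr' hR'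
  have hww : zNorm (w - w') = zNorm (w' - w) := zNorm_sub_comm _ _
  have hstart : ∀ {p : Site 2}, zNorm (p - w) = r → zNorm (p - w') < r' := fun {p} hp ↦ by
    have := zNorm_sub_le_add p w w'; omega
  have hend : ∀ {q : Site 2}, zNorm (q - w) = R → (R' : ℤ) ≤ zNorm (q - w') := fun {q} hq ↦ by
    have := zNorm_sub_le_add q w' w; omega
  obtain ⟨p₁', q₁', hp₁', hq₁', hc₁, hj₁⟩ := exists_zAnn_crossing_of_pathIn hHG hrR' (hstart hp₁) (hend hq₁) h₁
  obtain ⟨p₂', q₂', hp₂', hq₂', hc₂, hj₂⟩ := exists_zAnn_crossing_of_pathIn hHG hrR' (hstart hp₂) (hend hq₂) h₂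
  refine mem_fourArmTwoClustersAt_of_crossings (by omega) hrR' hp₁' hq₁' hp₂' hq₂' (hc₁.mono inter_subset_right)
    (hc₂.mono inter_subset_right) fun h12 ↦ hn ?_
  exact hj₁.trans ((h12.mono hsub).trans hj₂.symm)

/-! ## §3 Nets on the inner layer -/

/-- The point with coordinates `(a, b)`. -/
def mkPt (a b : ℤ) : Site 2 := fun i ↦ if i = 0 then a else b

/-- First coordinate of `mkPt`. -/
@[simp] theorem mkPt_zero (a b : ℤ) : mkPt a b 0 = a := by simp [mkPt]

/-- Second coordinate of `mkPt`. -/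
@[simp] theorem mkPt_one (a b : ℤ) : mkPt a b 1 = b := by simp [mkPt]

/-- The net point with side index `i` and offset index `j`: on the east, west, north, south inner-layer side of
`Λ_s(x)`, at offset `j D - s` along the side. -/
def ilNetPt (x : Site 2) (s D : ℕ) (p : Fin 4 × ℕ) : Site 2 :=
  match p.1 with
  | 0 => x + mkPt ((s : ℤ) + 1) ((p.2 : ℤ) * D - s)
  | 1 => x + mkPt (-((s : ℤ) + 1)) ((p.2 : ℤ) * D - s)
  | 2 => x + mkPt ((p.2 : ℤ) * D - s) ((s : ℤ) + 1)
  | 3 => x + mkPt ((p.2 : ℤ) * D - s) (-((s : ℤ) + 1))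

/-- **The `D`-net of the inner layer of `Λ_{2s}(x) ∖ Λ_s(x)`**: the net points of offsets `j D - s`,
`0 ≤ j ≤ 2s / D`, on the four sides. -/
def ilNet (x : Site 2) (s D : ℕ) : Finset (Site 2) :=
  ((Finset.univ : Finset (Fin 4)) ×ˢ Finset.range (2 * s / D + 1)).image (ilNetPt x s D)

/-- The net has at most `4 (2s/D + 1)` points. -/
theorem card_ilNet_le (x : Site 2) (s D : ℕ) : (ilNet x s D).card ≤ 4 * (2 * s / D + 1) := by
  refine Finset.card_image_le.trans ?_
  rw [Finset.card_product, Finset.card_univ, Fintype.card_fin, Finset.card_range]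

/-- A vertex just outside a side of the box, facing the box, is an inner-layer vertex. -/
theorem mem_innerLayer_of_coords {x w u : Site 2} {s : ℕ} (hwO : zNorm (w - x) ≤ (2 * s : ℕ))
    (hwI : ¬ zNorm (w - x) ≤ s) (hu : zNorm (u - x) ≤ s) (hadj : (zdGraph 2).Adj w u) :
    w ∈ innerLayer (zdGraph 2) (zBall x s) (zBall x (2 * s)) :=
  ⟨⟨hwO, hwI⟩, u, hu, hadj⟩

/-- Net points are inner-layer vertices (for `s ≥ 1`). -/
theorem ilNet_subset_innerLayer (x : Site 2) {s D : ℕ} (hs : 1 ≤ s) :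
    ↑(ilNet x s D) ⊆ innerLayer (zdGraph 2) (zBall x s) (zBall x (2 * s)) := by
  intro w hw
  rw [Finset.mem_coe, ilNet, Finset.mem_image] at hw
  obtain ⟨⟨i, j⟩, hij, rfl⟩ := hw
  rw [Finset.mem_product, Finset.mem_range] at hij
  have hj : j * D ≤ 2 * s := by
    have := Nat.div_mul_le_self (2 * s) D
    have h2 : j ≤ 2 * s / D := by omega
    exact (Nat.mul_le_mul_right D h2).trans this
  have hj' : ((j : ℤ) * D : ℤ) ≤ 2 * s := by exact_mod_cast hj
  have hj0 : (0 : ℤ) ≤ (j : ℤ) * D := by positivity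
  fin_cases i
  · refine mem_innerLayer_of_coords (u := x + mkPt (s : ℤ) ((j : ℤ) * D - s)) ?_ ?_ ?_ ?_
    · simp only [ilNetPt, add_sub_cancel_left, zNorm, mkPt_zero, mkPt_one, max_le_iff, abs_le]; push_cast; omega
    · simp only [ilNetPt, add_sub_cancel_left, zNorm, mkPt_zero, mkPt_one, max_le_iff, abs_le]; omega
    · simp only [add_sub_cancel_left, zNorm, mkPt_zero, mkPt_one, max_le_iff, abs_le]; omega
    · rw [zdGraph_two_adj_iff]; simp [ilNetPt, Pi.add_apply, add_assoc]
  · refine mem_innerLayer_of_coords (u := x + mkPt (-(s : ℤ)) ((j : ℤ) * D - s)) ?_ ?_ ?_ ?_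
    · simp only [ilNetPt, add_sub_cancel_left, zNorm, mkPt_zero, mkPt_one, max_le_iff, abs_le]; push_cast; omega
    · simp only [ilNetPt, add_sub_cancel_left, zNorm, mkPt_zero, mkPt_one, max_le_iff, abs_le]; omega
    · simp only [add_sub_cancel_left, zNorm, mkPt_zero, mkPt_one, max_le_iff, abs_le]; omega
    · rw [zdGraph_two_adj_iff]; simp [ilNetPt, Pi.add_apply, add_assoc]
  · refine mem_innerLayer_of_coords (u := x + mkPt ((j : ℤ) * D - s) (s : ℤ)) ?_ ?_ ?_ ?_
    · simp only [ilNetPt, add_sub_cancel_left, zNorm, mkPt_zero, mkPt_one, max_le_iff, abs_le]; push_cast; omega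
    · simp only [ilNetPt, add_sub_cancel_left, zNorm, mkPt_zero, mkPt_one, max_le_iff, abs_le]; omega
    · simp only [add_sub_cancel_left, zNorm, mkPt_zero, mkPt_one, max_le_iff, abs_le]; omega
    · rw [zdGraph_two_adj_iff]; simp [ilNetPt, Pi.add_apply, add_assoc]
  · refine mem_innerLayer_of_coords (u := x + mkPt ((j : ℤ) * D - s) (-(s : ℤ))) ?_ ?_ ?_ ?_
    · simp only [ilNetPt, add_sub_cancel_left, zNorm, mkPt_zero, mkPt_one, max_le_iff, abs_le]; push_cast; omega
    · simp only [ilNetPt, add_sub_cancel_left, zNorm, mkPt_zero, mkPt_one, max_le_iff, abs_le]; omega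
    · simp only [add_sub_cancel_left, zNorm, mkPt_zero, mkPt_one, max_le_iff, abs_le]; omega
    · rw [zdGraph_two_adj_iff]; simp [ilNetPt, Pi.add_apply, add_assoc]

/-- **Covering**: every inner-layer vertex is within sup distance `< D` of a net point (`D ≥ 1`). -/
theorem exists_mem_ilNet_near (x : Site 2) {s D : ℕ} (hD : 1 ≤ D) {v : Site 2}
    (hv : v ∈ innerLayer (zdGraph 2) (zBall x s) (zBall x (2 * s))) : ∃ w ∈ ilNet x s D, zNorm (v - w) < D := by
  obtain ⟨⟨-, hvI⟩, u, hu, hvu⟩ := hv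
  have hvI' : ¬ zNorm (v - x) ≤ s := hvI
  have hu' : zNorm (u - x) ≤ s := hu
  rw [zNorm_sub, max_le_iff, abs_le, abs_le] at hu'
  rw [zNorm_sub, max_le_iff, abs_le, abs_le, not_and_or] at hvI'
  rw [zdGraph_two_adj_iff] at hvu
  have hD' : (0 : ℤ) < D := by exact_mod_cast hD
  -- the offset index along a side, for an offset `t ∈ [-s, s]`
  have hidx : ∀ t : ℤ, -(s : ℤ) ≤ t → t ≤ s → ∃ j : ℕ, j < 2 * s / D + 1 ∧
      (0 : ℤ) ≤ t + s - (j : ℤ) * D ∧ t + s - (j : ℤ) * D < D := by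
    intro t ht1 ht2
    refine ⟨((t + s) / D).toNat, ?_, ?_, ?_⟩
    · have h1 : (t + s) / (D : ℤ) ≤ (2 * s : ℕ) / (D : ℤ) := Int.ediv_le_ediv hD' (by push_cast; omega)
      have h2 : ((2 * s : ℕ) : ℤ) / (D : ℤ) = ((2 * s / D : ℕ) : ℤ) := by push_cast; rfl
      have h3 : (0 : ℤ) ≤ (t + s) / D := Int.ediv_nonneg (by omega) hD'.le
      omega
    · have h3 : (0 : ℤ) ≤ (t + s) / D := Int.ediv_nonneg (by omega) hD'.le
      rw [Int.toNat_of_nonneg h3]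
      have := Int.mul_ediv_add_emod (t + s) (D : ℤ)
      have := Int.emod_nonneg (t + s) hD'.ne'
      linarith [mul_comm ((t + s) / (D : ℤ)) (D : ℤ)]
    · have h3 : (0 : ℤ) ≤ (t + s) / D := Int.ediv_nonneg (by omega) hD'.le
      rw [Int.toNat_of_nonneg h3]
      have := Int.mul_ediv_add_emod (t + s) (D : ℤ)
      have := Int.emod_lt_of_pos (t + s) hD'
      linarith [mul_comm ((t + s) / (D : ℤ)) (D : ℤ)]
  have mem : ∀ (i : Fin 4) (j : ℕ), j < 2 * s / D + 1 → ilNetPt x s D (i, j) ∈ ilNet x s D := fun i j hj ↦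
    Finset.mem_image_of_mem _ (Finset.mem_product.2 ⟨Finset.mem_univ _, Finset.mem_range.2 hj⟩)
  -- which side is `v` on: read off the box neighbour `u`
  rcases hvu with ⟨h0, h1⟩ | ⟨h0, h1⟩ | ⟨h0, h1⟩ | ⟨h0, h1⟩
  · -- `u = v + e₀`: west side, `v 0 = x 0 - (s+1)`
    obtain ⟨j, hj, hj1, hj2⟩ := hidx (v 1 - x 1) (by omega) (by omega)
    refine ⟨_, mem 1 j hj, ?_⟩
    simp only [ilNetPt, zNorm_sub, Pi.add_apply, mkPt_zero, mkPt_one]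
    refine max_lt ?_ ?_ <;> rw [abs_lt] <;> constructor <;> omega
  · -- `u = v + e₁`: south side
    obtain ⟨j, hj, hj1, hj2⟩ := hidx (v 0 - x 0) (by omega) (by omega)
    refine ⟨_, mem 3 j hj, ?_⟩
    simp only [ilNetPt, zNorm_sub, Pi.add_apply, mkPt_zero, mkPt_one]
    refine max_lt ?_ ?_ <;> rw [abs_lt] <;> constructor <;> omega
  · -- `v = u + e₀`: east side
    obtain ⟨j, hj, hj1, hj2⟩ := hidx (v 1 - x 1) (by omega) (by omega)
    refine ⟨_, mem 0 j hj, ?_⟩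
    simp only [ilNetPt, zNorm_sub, Pi.add_apply, mkPt_zero, mkPt_one]
    refine max_lt ?_ ?_ <;> rw [abs_lt] <;> constructor <;> omega
  · -- `v = u + e₁`: north side
    obtain ⟨j, hj, hj1, hj2⟩ := hidx (v 0 - x 0) (by omega) (by omega)
    refine ⟨_, mem 2 j hj, ?_⟩
    simp only [ilNetPt, zNorm_sub, Pi.add_apply, mkPt_zero, mkPt_one]
    refine max_lt ?_ ?_ <;> rw [abs_lt] <;> constructor <;> omega

end NeckCoarseZ2

/-! ## §4 The union bound over the inner layer (`k = 1` layer of the summation) -/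

/-- **Four arms around SOME inner-layer vertex: position entropy against the four-arm cost (registered helper, anchor
of this module on the crux item).**  With the constants `c, ε > 0` of `QuadCrossing.fourArm_bound`: for all centres
`x`, radii `s`, resolutions `D ≥ 1` and radii `1 ≤ r`, `r + D + 1 ≤ R - D`, the probability that some inner-layer
vertex of the collar `Λ_{2s}(x) ∖ Λ_s(x)` is surrounded by the cluster-form four-arm event from radius `r` to radius
`R` is at most `4 (2s/D + 1) · c ((r + D + 1) / (R - D))^{1+ε}` (recentre to the `D`-net of the inner layer,
`P_{1/2}`-a.s. lattice configurations, union bound, translation invariance, four-arm bound). -/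
theorem real_exists_fourArm_innerLayer_le : ∃ c ε : ℝ, 0 < c ∧ 0 < ε ∧ ∀ (x : Site 2) (s D r R : ℕ), 1 ≤ D → 1 ≤ r → r + D + 1 ≤ R - D → (bondPercolation (zdGraph 2) half).real {ω | ∃ v ∈ innerLayer (zdGraph 2) (zBall x s) (zBall x (2 * s)), ω ∈ fourArmTwoClustersAt v r R} ≤ 4 * ((2 * s / D + 1 : ℕ) : ℝ) * (c * (((r + D + 1 : ℕ) : ℝ) / ((R - D : ℕ) : ℝ)) ^ (1 + ε)) := by
  obtain ⟨c, ε, hc, hε, h4⟩ := QuadCrossing.fourArm_bound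
  refine ⟨c, ε, hc, hε, fun x s D r R hD hr hrR ↦ ?_⟩
  set μ := bondPercolation (zdGraph 2) half with hμ
  set r' := r + D + 1 with hr'
  set R' := R - D with hR'
  have hr'1 : 1 ≤ r' := by omega
  -- recentre to the net, off a null set
  have hcover : {ω | ∃ v ∈ innerLayer (zdGraph 2) (zBall x s) (zBall x (2 * s)), ω ∈ fourArmTwoClustersAt v r R} ∩
      {ω | ω ⊆ (zdGraph 2).edgeSet} ⊆ ⋃ w ∈ NeckCoarseZ2.ilNet x s D, fourArmTwoClustersAt w r' R' := by
    rintro ω ⟨⟨v, hv, hω⟩, hlat⟩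
    obtain ⟨w, hw, hvw⟩ := NeckCoarseZ2.exists_mem_ilNet_near x hD hv
    have hHG : ∀ a b, (openGraph ω).Adj a b → (zdGraph 2).Adj a b := fun a b h ↦
      (SimpleGraph.mem_edgeSet _).1 (hlat ((openGraph_adj ω a b).1 h).1)
    have hd : zNorm (w - v) ≤ D := by rw [NeckCoarseZ2.zNorm_sub_comm]; exact hvw.le
    exact mem_biUnion hw (NeckCoarseZ2.fourArmTwoClustersAt_of_near hHG hd hr le_rfl (by omega) (by omega) hω)
  have hae : ∀ᵐ ω ∂μ, ω ⊆ (zdGraph 2).edgeSet := ae_subset_edgeSet (zdGraph 2) half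
  have heq : μ.real {ω | ∃ v ∈ innerLayer (zdGraph 2) (zBall x s) (zBall x (2 * s)), ω ∈ fourArmTwoClustersAt v r R} =
      μ.real ({ω | ∃ v ∈ innerLayer (zdGraph 2) (zBall x s) (zBall x (2 * s)), ω ∈ fourArmTwoClustersAt v r R} ∩
        {ω | ω ⊆ (zdGraph 2).edgeSet}) := by
    refine measureReal_congr (Filter.eventuallyEq_set.2 (hae.mono fun ω hω ↦ ?_))
    simp only [mem_inter_iff, mem_setOf_eq, hω, and_true]
  rw [heq]
  calc μ.real ({ω | ∃ v ∈ innerLayer (zdGraph 2) (zBall x s) (zBall x (2 * s)), ω ∈ fourArmTwoClustersAt v r R} ∩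
        {ω | ω ⊆ (zdGraph 2).edgeSet})
      ≤ μ.real (⋃ w ∈ NeckCoarseZ2.ilNet x s D, fourArmTwoClustersAt w r' R') := measureReal_mono hcover (measure_ne_top _ _)
    _ ≤ ∑ w ∈ NeckCoarseZ2.ilNet x s D, μ.real (fourArmTwoClustersAt w r' R') := measureReal_biUnion_finset_le _ _
    _ ≤ ∑ _w ∈ NeckCoarseZ2.ilNet x s D, c * ((r' : ℝ) / R') ^ (1 + ε) := by
        refine Finset.sum_le_sum fun w _ ↦ ?_
        rw [real_fourArmTwoClustersAt]
        exact h4 r' R' hr'1 (by omega)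
    _ = (NeckCoarseZ2.ilNet x s D).card * (c * ((r' : ℝ) / R') ^ (1 + ε)) := by
        rw [Finset.sum_const, nsmul_eq_mul]
    _ ≤ 4 * ((2 * s / D + 1 : ℕ) : ℝ) * (c * (((r + D + 1 : ℕ) : ℝ) / ((R - D : ℕ) : ℝ)) ^ (1 + ε)) := by
        have hcard : ((NeckCoarseZ2.ilNet x s D).card : ℝ) ≤ 4 * ((2 * s / D + 1 : ℕ) : ℝ) := by
          exact_mod_cast NeckCoarseZ2.card_ilNet_le x s D
        have hnn : 0 ≤ c * (((r + D + 1 : ℕ) : ℝ) / ((R - D : ℕ) : ℝ)) ^ (1 + ε) := by positivity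
        simpa [hr', hR'] using mul_le_mul_of_nonneg_right hcard hnn

end Summit.CriticalPhenomena.CardyFormulaZ2.Cruxes.NestingRigidity.PinchResampling

end
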